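import Literature.Probability.RandomPlanarGeometry.SupercriticalSAWPolygons
import Literature.Probability.Percolation.SiteConnectionTools
import Literature.Probability.LatticeModels.IsoradialGraphsProofs
import HarnessLib

/-!
# Four squared walks make a polygon of `P_m` (Duminil-Copin–Kozma–Yadin 2014, proof of
# Proposition 3): the construction, as an injection into `facePolygons m`

Topic `Literature/Probability/RandomPlanarGeometry` (continues `SupercriticalSAWPolygons.lean`,
whose `IsSquaredWalk`, `diag`, `squareBox`, `cardinalEdges`, `facePolygons m = P_m`,
`IsPolygon` are used). Source: H. Duminil-Copin, G. Kozma, A. Yadin, *Supercritical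
self-avoiding walks are space-filling*, Ann. IHP Probab. Stat. 50 (2014) 315–326
(arXiv:1110.3074), §2, proof of Proposition 3:

> "From any quadruplet `(γ₁,γ₂,γ₃,γ₄)` of such squared self-avoiding walks, one can construct a
> self-avoiding polygon of `P_m` as follows: translate `γ₁` and `γ₃` by `(m+1,0)` and `(0,m+1)`
> respectively; rotate `γ₂` and `γ₄` by an angle `π/2`, and then translate them by `(m,0)` and
> `(2m+1,m+1)` respectively; add the four edges `[(m,0),(m+1,0)]`, `[(2m+1,m),(2m+1,m+1)]`,
> `[(m,2m+1),(m+1,2m+1)]` and `[(0,m),(0,m+1)]`. Since each walk is contained in a square, one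
> can easily check that we obtain a `(4n+4)`-step polygon in `P_m`."

This file carries out exactly this construction over Mathlib's `SimpleGraph.Walk` and the
tree's lattice automorphisms (`zdShiftIso`, `zdSignedPermIso` of
`Literature/Probability/Percolation/SiteConnectionTools.lean`; the unit steps
`zdGraph_two_adj_east`, `zdGraph_two_adj_north` of
`Literature/Probability/LatticeModels/IsoradialGraphsProofs.lean`), and proves what "one can
easily check": the closed walk `polygonWalk m γ₁ γ₂ γ₃ γ₄` is a cycle of length `4n+4` inside
`[0,2m+1]²` through the four cardinal edges (`polygonWalk_isCycle`, `length_polygonWalk`,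
`polygonEdges_mem_facePolygons`, `card_polygonEdges`), and the quadruple is recovered from the
edge set (`polygonEdges_injective`: the four quarters of `[0,2m+1]²` are told apart by the two
predicates `m+1 ≤ w₀`, `m+1 ≤ w₁`, and a self-avoiding walk is determined by its edge set,
`eq_of_isPath_of_edges_toFinset_eq`). The counting consequence `Z_m(x) ≥ (#squared walks)⁴ x^{4n+4}`
and Proposition 3 from Lemma 5 are in `SupercriticalSAWProp3.lean`.

Placement of the four walks (a squared walk `γ` of span `m` runs from `(0,0)` to `(m,m)` inside
`[0,m]²`): `brWalk` = `γ₁ + (m+1,0)` from `(m+1,0)` to `(2m+1,m)` (bottom-right quarter),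
`blWalk` = `ρ γ₂ + (m,0)` from `(m,0)` to `(0,m)` (bottom-left; `ρ(x,y) = (-y,x)`),
`tlWalk` = `γ₃ + (0,m+1)` from `(0,m+1)` to `(m,2m+1)` (top-left), `trWalk` = `ρ γ₄ + (2m+1,m+1)`
from `(2m+1,m+1)` to `(m+1,2m+1)` (top-right). The polygon is traversed as
`(m,0) → (m+1,0) ⇝ (2m+1,m) → (2m+1,m+1) ⇝ (m+1,2m+1) → (m,2m+1) ⇝ (0,m+1) → (0,m) ⇝ (m,0)`
(`brWalk`, `trWalk`, `tlWalk` reversed, `blWalk` reversed, joined by the four cardinal edges).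
-/

noncomputable section

open SimpleGraph Literature.Probability.LatticeModels Literature.Probability.Percolation

namespace Literature.Probability.RandomPlanarGeometry.SAW

/-! ### Two facts about self-avoiding walks in a simple graph -/

section Walks

variable {V : Type*} {G : SimpleGraph V}

/-- Appending a path, an edge and a path with disjoint supports gives a path. [folklore] -/
theorem isPath_append_cons {a b c d : V} {p : G.Walk a b} {q : G.Walk c d} (h : G.Adj b c)
    (hp : p.IsPath) (hq : q.IsPath) (hdis : ∀ x ∈ p.support, x ∉ q.support) :
    (p.append (Walk.cons h q)).IsPath := by
  rw [Walk.isPath_def, Walk.support_append, Walk.support_cons, List.tail_cons, List.nodup_append]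
  exact ⟨(Walk.isPath_def _).1 hp, (Walk.isPath_def _).1 hq,
    fun x hx y hy hxy => hdis x hx (hxy ▸ hy)⟩

/-- Every vertex of an edge of a walk lies on the walk. [folklore] -/
theorem mem_support_of_mem_edges' {u v : V} (p : G.Walk u v) {e : Sym2 V} (he : e ∈ p.edges)
    {x : V} (hx : x ∈ e) : x ∈ p.support := by
  induction e using Sym2.ind with
  | _ a b =>
    rcases Sym2.mem_iff.1 hx with rfl | rfl
    · exact p.fst_mem_support_of_mem_edges he
    · exact p.snd_mem_support_of_mem_edges he

/-- **A self-avoiding walk is determined by its endpoints and its set of edges.** [folklore] -/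
theorem eq_of_isPath_of_edges_toFinset_eq [DecidableEq V] {u v : V} {p : G.Walk u v}
    (hp : p.IsPath) : ∀ {q : G.Walk u v}, q.IsPath → p.edges.toFinset = q.edges.toFinset →
      p = q := by
  induction p with
  | nil =>
    intro q hq _
    exact ((Walk.isPath_iff_nil).1 hq).eq_nil.symm
  | cons hadj p' ih =>
    rename_i u w v
    intro q hq h
    have hp' : p'.IsPath ∧ u ∉ p'.support := (Walk.cons_isPath_iff _ _).1 hp
    cases q with
    | nil => exact absurd ((Walk.isPath_iff_nil).1 hp) Walk.not_nil_cons
    | cons hadj' q' =>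
      rename_i w'
      have hq' : q'.IsPath ∧ u ∉ q'.support := (Walk.cons_isPath_iff _ _).1 hq
      -- the first edge of `q` is an edge of `p` at `u`, hence the first edge of `p`
      have hmem : s(u, w') ∈ (Walk.cons hadj p').edges.toFinset := by
        rw [h, List.mem_toFinset, Walk.edges_cons]
        exact List.mem_cons_self
      rw [List.mem_toFinset, Walk.edges_cons, List.mem_cons] at hmem
      have hw : w' = w := by
        rcases hmem with he | he
        · exact Sym2.congr_right.1 he
        · exact absurd (p'.fst_mem_support_of_mem_edges he) hp'.2
      subst hw
      have h1 : s(u, w') ∉ p'.edges.toFinset := fun he =>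
        hp'.2 (p'.fst_mem_support_of_mem_edges (List.mem_toFinset.1 he))
      have h2 : s(u, w') ∉ q'.edges.toFinset := fun he =>
        hq'.2 (q'.fst_mem_support_of_mem_edges (List.mem_toFinset.1 he))
      have h' : p'.edges.toFinset = q'.edges.toFinset := by
        simp only [Walk.edges_cons, List.toFinset_cons] at h
        rw [← Finset.erase_insert h1, h, Finset.erase_insert h2]
      rw [ih hp'.1 hq'.1 h']

end Walks

/-! ### Lattice bookkeeping on `ℤ²` -/

/-- The rotation `ρ(x,y) = (-y,x)` by `π/2` about the origin, as an automorphism of `ℤ²`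
(the signed coordinate permutation `zdSignedPermIso (swap 0 1) (-1,1)`).
[cite: DuminilCopinKozmaYadin2014, §2 (proof of Proposition 3: "rotate γ₂ and γ₄ by an angle π/2")] -/
def rotIso : zdGraph 2 ≃g zdGraph 2 :=
  zdSignedPermIso (Equiv.swap 0 1) fun i => if i = 0 then -1 else 1

/-- `ρ(x,y) = (-y,x)`. [cite: DuminilCopinKozmaYadin2014, §2 (proof of Proposition 3)] -/
@[simp] theorem rotIso_apply (w : Site 2) : rotIso w = ![-(w 1), w 0] := by
  funext i; fin_cases i <;> simp [rotIso, zdSignedPermIso]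

/-- Rotation by `π/2` followed by the translation by `v`, as an automorphism of `ℤ²`.
[cite: DuminilCopinKozmaYadin2014, §2 (proof of Proposition 3)] -/
def rotShiftIso (v : Site 2) : zdGraph 2 ≃g zdGraph 2 :=
  rotIso.trans (zdShiftIso v)

/-- `(ρ, then + v)(x,y) = (-y,x) + v`. [cite: DuminilCopinKozmaYadin2014, §2 (proof of Proposition 3)] -/
@[simp] theorem rotShiftIso_apply (v w : Site 2) : rotShiftIso v w = ![-(w 1), w 0] + v := by
  simp [rotShiftIso, RelIso.trans_apply]

/-- The "signature" of a site relative to the span `m`: which of `m+1 ≤ w₀`, `m+1 ≤ w₁` hold.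
It is constant on each quarter of `[0,2m+1]²` and tells the four quarters apart. [folklore] -/
def sig (m : ℕ) (w : Site 2) : Bool × Bool :=
  (decide ((m : ℤ) + 1 ≤ w 0), decide ((m : ℤ) + 1 ≤ w 1))

open Classical in
/-- The edges all of whose endpoints have signature `q`. [folklore] -/
def sigEdges (m : ℕ) (q : Bool × Bool) (E : Finset (Sym2 (Site 2))) : Finset (Sym2 (Site 2)) :=
  E.filter fun e => ∀ x ∈ e, sig m x = q

/-- `sigEdges` of a union. [folklore] -/
theorem sigEdges_union (m : ℕ) (q : Bool × Bool) (E F : Finset (Sym2 (Site 2))) :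
    sigEdges m q (E ∪ F) = sigEdges m q E ∪ sigEdges m q F := by
  classical
  unfold sigEdges; convert Finset.filter_union _ E F

/-- An edge whose endpoints have different signatures is discarded by every `sigEdges`.
[folklore] -/
theorem sigEdges_insert_of_ne (m : ℕ) (q : Bool × Bool) {a b : Site 2} (h : sig m a ≠ sig m b)
    (E : Finset (Sym2 (Site 2))) : sigEdges m q (insert s(a, b) E) = sigEdges m q E := by
  classical
  unfold sigEdges
  rw [Finset.filter_insert, if_neg]
  intro hall
  exact h ((hall a (Sym2.mem_mk_left a b)).trans (hall b (Sym2.mem_mk_right a b)).symm)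

/-- The edges of a walk all of whose vertices have signature `q₀` are kept by `sigEdges q₀` and
discarded by the other three. [folklore] -/
theorem sigEdges_edges_toFinset (m : ℕ) (q q₀ : Bool × Bool) {u v : Site 2}
    (p : (zdGraph 2).Walk u v) (hp : ∀ w ∈ p.support, sig m w = q₀) :
    sigEdges m q p.edges.toFinset = if q = q₀ then p.edges.toFinset else ∅ := by
  classical
  unfold sigEdges
  split_ifs with hq
  · subst hq
    refine Finset.filter_true_of_mem fun e he x hx => hp x ?_
    exact mem_support_of_mem_edges' p (List.mem_toFinset.1 he) hx
  · refine Finset.filter_false_of_mem fun e he hall => hq ?_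
    induction e using Sym2.ind with
    | _ a b =>
      rw [← hall a (Sym2.mem_mk_left a b)]
      exact hp a (mem_support_of_mem_edges' p (List.mem_toFinset.1 he) (Sym2.mem_mk_left a b))

/-! ### The four placed walks -/

namespace SquaredWalkPolygon

variable (m : ℕ)

/-- `γ₁ + (m+1, 0)`: from `(m+1,0)` to `(2m+1,m)`, in the bottom-right quarter.
[cite: DuminilCopinKozmaYadin2014, §2 (proof of Proposition 3)] -/
def brWalk (γ : (zdGraph 2).Walk (0 : Site 2) (diag m)) :
    (zdGraph 2).Walk ![(m : ℤ) + 1, 0] ![2 * (m : ℤ) + 1, m] :=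
  (γ.map (zdShiftIso ![(m : ℤ) + 1, 0]).toHom).copy
    (by funext i; fin_cases i <;> simp)
    (by funext i; fin_cases i
        · simp [diag]; ring
        · simp [diag])

/-- `γ₃ + (0, m+1)`: from `(0,m+1)` to `(m,2m+1)`, in the top-left quarter.
[cite: DuminilCopinKozmaYadin2014, §2 (proof of Proposition 3)] -/
def tlWalk (γ : (zdGraph 2).Walk (0 : Site 2) (diag m)) :
    (zdGraph 2).Walk ![0, (m : ℤ) + 1] ![(m : ℤ), 2 * (m : ℤ) + 1] :=
  (γ.map (zdShiftIso ![0, (m : ℤ) + 1]).toHom).copy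
    (by funext i; fin_cases i <;> simp)
    (by funext i; fin_cases i
        · simp [diag]
        · simp [diag]; ring)

/-- `ρ γ₂ + (m, 0)`: from `(m,0)` to `(0,m)`, in the bottom-left quarter.
[cite: DuminilCopinKozmaYadin2014, §2 (proof of Proposition 3)] -/
def blWalk (γ : (zdGraph 2).Walk (0 : Site 2) (diag m)) :
    (zdGraph 2).Walk ![(m : ℤ), 0] ![0, (m : ℤ)] :=
  (γ.map (rotShiftIso ![(m : ℤ), 0]).toHom).copy
    (by funext i; fin_cases i <;> simp)
    (by funext i; fin_cases i <;> simp [diag])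

/-- `ρ γ₄ + (2m+1, m+1)`: from `(2m+1,m+1)` to `(m+1,2m+1)`, in the top-right quarter.
[cite: DuminilCopinKozmaYadin2014, §2 (proof of Proposition 3)] -/
def trWalk (γ : (zdGraph 2).Walk (0 : Site 2) (diag m)) :
    (zdGraph 2).Walk ![2 * (m : ℤ) + 1, (m : ℤ) + 1] ![(m : ℤ) + 1, 2 * (m : ℤ) + 1] :=
  (γ.map (rotShiftIso ![2 * (m : ℤ) + 1, (m : ℤ) + 1]).toHom).copy
    (by funext i; fin_cases i <;> simp)
    (by funext i; fin_cases i
        · simp [diag]; ring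
        · simp [diag]; ring)

variable {m}

/-- The four placements are injective in `γ`. [folklore] -/
theorem copy_map_injective {u v u' v' : Site 2} (φ : zdGraph 2 ≃g zdGraph 2) (hu : φ u = u')
    (hv : φ v = v') :
    Function.Injective fun γ : (zdGraph 2).Walk u v => (γ.map φ.toHom).copy hu hv := by
  intro γ γ' h
  have h' := congrArg (fun q => q.copy hu.symm hv.symm) h
  simp only [Walk.copy_copy, Walk.copy_rfl_rfl] at h'
  exact Walk.map_injective_of_injective (RelIso.injective φ) _ _ h'

/-- A squared walk of span `m`: a self-avoiding walk from `(0,0)` to `(m,m)` inside `[0,m]²`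
(the data of `IsSquaredWalk` with the span made explicit). [cite: DuminilCopinKozmaYadin2014, §2 (squared walks)] -/
def IsSq (m : ℕ) (γ : (zdGraph 2).Walk (0 : Site 2) (diag m)) : Prop :=
  γ.IsPath ∧ ∀ w ∈ γ.support, ∀ i, 0 ≤ w i ∧ w i ≤ m

/-- `IsSquaredWalk` at the endpoint `diag m` is `IsSq m`. [cite: DuminilCopinKozmaYadin2014, §2 (squared walks)] -/
theorem isSq_of_isSquaredWalk {γ : (zdGraph 2).Walk (0 : Site 2) (diag m)} (h : IsSquaredWalk γ) :
    IsSq m γ := by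
  obtain ⟨hp, k, hk, hb⟩ := h
  have hkm : k = m := by
    have := congrFun hk 0
    simp only [diag, Nat.cast_inj] at this
    exact this.symm
  subst hkm
  exact ⟨hp, hb⟩

section Supports

variable {γ : (zdGraph 2).Walk (0 : Site 2) (diag m)}

/-- Vertices of `brWalk`: `m+1 ≤ w₀ ≤ 2m+1`, `0 ≤ w₁ ≤ m`. [cite: DuminilCopinKozmaYadin2014, §2 (proof of Proposition 3)] -/
theorem mem_support_brWalk (hγ : IsSq m γ) {w : Site 2} (hw : w ∈ (brWalk m γ).support) :
    ((m : ℤ) + 1 ≤ w 0 ∧ w 0 ≤ 2 * m + 1) ∧ (0 ≤ w 1 ∧ w 1 ≤ m) := by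
  rw [brWalk, Walk.support_copy, Walk.support_map, List.mem_map] at hw
  obtain ⟨u, hu, rfl⟩ := hw
  have h0 := hγ.2 u hu 0
  have h1 := hγ.2 u hu 1
  simp [Iso.toHom]
  omega

/-- Vertices of `tlWalk`: `0 ≤ w₀ ≤ m`, `m+1 ≤ w₁ ≤ 2m+1`. [cite: DuminilCopinKozmaYadin2014, §2 (proof of Proposition 3)] -/
theorem mem_support_tlWalk (hγ : IsSq m γ) {w : Site 2} (hw : w ∈ (tlWalk m γ).support) :
    (0 ≤ w 0 ∧ w 0 ≤ m) ∧ ((m : ℤ) + 1 ≤ w 1 ∧ w 1 ≤ 2 * m + 1) := by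
  rw [tlWalk, Walk.support_copy, Walk.support_map, List.mem_map] at hw
  obtain ⟨u, hu, rfl⟩ := hw
  have h0 := hγ.2 u hu 0
  have h1 := hγ.2 u hu 1
  simp [Iso.toHom]
  omega

/-- Vertices of `blWalk`: `0 ≤ w₀ ≤ m`, `0 ≤ w₁ ≤ m`. [cite: DuminilCopinKozmaYadin2014, §2 (proof of Proposition 3)] -/
theorem mem_support_blWalk (hγ : IsSq m γ) {w : Site 2} (hw : w ∈ (blWalk m γ).support) :
    (0 ≤ w 0 ∧ w 0 ≤ m) ∧ (0 ≤ w 1 ∧ w 1 ≤ m) := by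
  rw [blWalk, Walk.support_copy, Walk.support_map, List.mem_map] at hw
  obtain ⟨u, hu, rfl⟩ := hw
  have h0 := hγ.2 u hu 0
  have h1 := hγ.2 u hu 1
  simp [Iso.toHom]
  omega

/-- Vertices of `trWalk`: `m+1 ≤ w₀ ≤ 2m+1`, `m+1 ≤ w₁ ≤ 2m+1`. [cite: DuminilCopinKozmaYadin2014, §2 (proof of Proposition 3)] -/
theorem mem_support_trWalk (hγ : IsSq m γ) {w : Site 2} (hw : w ∈ (trWalk m γ).support) :
    ((m : ℤ) + 1 ≤ w 0 ∧ w 0 ≤ 2 * m + 1) ∧ ((m : ℤ) + 1 ≤ w 1 ∧ w 1 ≤ 2 * m + 1) := by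
  rw [trWalk, Walk.support_copy, Walk.support_map, List.mem_map] at hw
  obtain ⟨u, hu, rfl⟩ := hw
  have h0 := hγ.2 u hu 0
  have h1 := hγ.2 u hu 1
  simp [Iso.toHom]
  omega

/-- The placed walks are self-avoiding. [cite: DuminilCopinKozmaYadin2014, §2 (proof of Proposition 3)] -/
theorem isPath_placed (hγ : IsSq m γ) :
    (brWalk m γ).IsPath ∧ (tlWalk m γ).IsPath ∧ (blWalk m γ).IsPath ∧ (trWalk m γ).IsPath := by
  refine ⟨?_, ?_, ?_, ?_⟩ <;>
    first
    | exact (Walk.isPath_copy _ _ _).2 (hγ.1.map (RelIso.injective _))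

/-- The placed walks have the length of `γ`. [cite: DuminilCopinKozmaYadin2014, §2 (proof of Proposition 3)] -/
theorem length_placed (γ : (zdGraph 2).Walk (0 : Site 2) (diag m)) :
    (brWalk m γ).length = γ.length ∧ (tlWalk m γ).length = γ.length ∧
      (blWalk m γ).length = γ.length ∧ (trWalk m γ).length = γ.length := by
  refine ⟨?_, ?_, ?_, ?_⟩
  · rw [brWalk, Walk.length_copy, Walk.length_map]
  · rw [tlWalk, Walk.length_copy, Walk.length_map]
  · rw [blWalk, Walk.length_copy, Walk.length_map]
  · rw [trWalk, Walk.length_copy, Walk.length_map]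

/-- Signatures of the vertices of the placed walks. [folklore] -/
theorem sig_placed (hγ : IsSq m γ) :
    (∀ w ∈ (brWalk m γ).support, sig m w = (true, false)) ∧
    (∀ w ∈ (tlWalk m γ).support, sig m w = (false, true)) ∧
    (∀ w ∈ (blWalk m γ).support, sig m w = (false, false)) ∧
    (∀ w ∈ (trWalk m γ).support, sig m w = (true, true)) := by
  refine ⟨fun w hw => ?_, fun w hw => ?_, fun w hw => ?_, fun w hw => ?_⟩
  · have := mem_support_brWalk hγ hw
    simp only [sig, Prod.mk.injEq, decide_eq_true_eq, decide_eq_false_iff_not, not_le]; omega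
  · have := mem_support_tlWalk hγ hw
    simp only [sig, Prod.mk.injEq, decide_eq_true_eq, decide_eq_false_iff_not, not_le]; omega
  · have := mem_support_blWalk hγ hw
    simp only [sig, Prod.mk.injEq, decide_eq_false_iff_not, not_le]; omega
  · have := mem_support_trWalk hγ hw
    simp only [sig, Prod.mk.injEq, decide_eq_true_eq]; omega

end Supports

/-! ### The polygon -/

section Polygon

variable (m)

/-- `(m,0) ∼ (m+1,0)` (bottom cardinal edge). [cite: DuminilCopinKozmaYadin2014, §2 (definition of P_m)] -/
theorem adjB : (zdGraph 2).Adj ![(m : ℤ), 0] ![(m : ℤ) + 1, 0] := zdGraph_two_adj_east _ _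

/-- `(2m+1,m) ∼ (2m+1,m+1)` (right cardinal edge). [cite: DuminilCopinKozmaYadin2014, §2 (definition of P_m)] -/
theorem adjR : (zdGraph 2).Adj ![2 * (m : ℤ) + 1, m] ![2 * (m : ℤ) + 1, (m : ℤ) + 1] :=
  zdGraph_two_adj_north _ _

/-- `(m+1,2m+1) ∼ (m,2m+1)` (top cardinal edge, traversed leftwards). [cite: DuminilCopinKozmaYadin2014, §2 (definition of P_m)] -/
theorem adjT : (zdGraph 2).Adj ![(m : ℤ) + 1, 2 * (m : ℤ) + 1] ![(m : ℤ), 2 * (m : ℤ) + 1] :=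
  (zdGraph_two_adj_east _ _).symm

/-- `(0,m+1) ∼ (0,m)` (left cardinal edge, traversed downwards). [cite: DuminilCopinKozmaYadin2014, §2 (definition of P_m)] -/
theorem adjL : (zdGraph 2).Adj ![0, (m : ℤ) + 1] ![0, (m : ℤ)] :=
  (zdGraph_two_adj_north _ _).symm

variable (γ₁ γ₂ γ₃ γ₄ : (zdGraph 2).Walk (0 : Site 2) (diag m))

/-- Stage 2: `blWalk` reversed, `(0,m) ⇝ (m,0)`. [cite: DuminilCopinKozmaYadin2014, §2 (proof of Proposition 3)] -/
def w2 : (zdGraph 2).Walk ![0, (m : ℤ)] ![(m : ℤ), 0] :=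
  (blWalk m γ₂).reverse

/-- Stage 3: `tlWalk` reversed, the left cardinal edge, stage 2: `(m,2m+1) ⇝ (m,0)`.
[cite: DuminilCopinKozmaYadin2014, §2 (proof of Proposition 3)] -/
def w3 : (zdGraph 2).Walk ![(m : ℤ), 2 * (m : ℤ) + 1] ![(m : ℤ), 0] :=
  (tlWalk m γ₃).reverse.append (Walk.cons (adjL m) (w2 m γ₂))

/-- Stage 4: `trWalk`, the top cardinal edge, stage 3: `(2m+1,m+1) ⇝ (m,0)`.
[cite: DuminilCopinKozmaYadin2014, §2 (proof of Proposition 3)] -/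
def w4 : (zdGraph 2).Walk ![2 * (m : ℤ) + 1, (m : ℤ) + 1] ![(m : ℤ), 0] :=
  (trWalk m γ₄).append (Walk.cons (adjT m) (w3 m γ₂ γ₃))

/-- Stage 1: `brWalk`, the right cardinal edge, stage 4: `(m+1,0) ⇝ (m,0)`.
[cite: DuminilCopinKozmaYadin2014, §2 (proof of Proposition 3)] -/
def w1 : (zdGraph 2).Walk ![(m : ℤ) + 1, 0] ![(m : ℤ), 0] :=
  (brWalk m γ₁).append (Walk.cons (adjR m) (w4 m γ₂ γ₃ γ₄))

/-- **The polygon built from four squared walks**: the closed walk at `(m,0)` consisting of the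
bottom cardinal edge followed by stage 1. [cite: DuminilCopinKozmaYadin2014, §2 (proof of Proposition 3)] -/
def polygonWalk : (zdGraph 2).Walk ![(m : ℤ), 0] ![(m : ℤ), 0] :=
  Walk.cons (adjB m) (w1 m γ₁ γ₂ γ₃ γ₄)

/-- The edge set of the polygon. [cite: DuminilCopinKozmaYadin2014, §2 (proof of Proposition 3)] -/
def polygonEdges : Finset (Sym2 (Site 2)) :=
  (polygonWalk m γ₁ γ₂ γ₃ γ₄).edges.toFinset

variable {m γ₁ γ₂ γ₃ γ₄}

/-- Stage 1 is a self-avoiding walk (the four quarters are pairwise disjoint).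
[cite: DuminilCopinKozmaYadin2014, §2 (proof of Proposition 3)] -/
theorem w1_isPath (h₁ : IsSq m γ₁) (h₂ : IsSq m γ₂) (h₃ : IsSq m γ₃) (h₄ : IsSq m γ₄) :
    (w1 m γ₁ γ₂ γ₃ γ₄).IsPath := by
  -- stage 2: vertices in the bottom-left quarter
  have hw2 : (w2 m γ₂).IsPath ∧ ∀ w ∈ (w2 m γ₂).support, w 0 ≤ m ∧ w 1 ≤ m := by
    refine ⟨(isPath_placed h₂).2.2.1.reverse, fun w hw => ?_⟩
    rw [w2, Walk.support_reverse, List.mem_reverse] at hw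
    have := mem_support_blWalk h₂ hw
    exact ⟨this.1.2, this.2.2⟩
  -- stage 3: vertices in the left half
  have hw3 : (w3 m γ₂ γ₃).IsPath ∧ ∀ w ∈ (w3 m γ₂ γ₃).support, w 0 ≤ m := by
    refine ⟨isPath_append_cons _ (isPath_placed h₃).2.1.reverse hw2.1 fun x hx hx' => ?_,
      fun w hw => ?_⟩
    · rw [Walk.support_reverse, List.mem_reverse] at hx
      have h1 := (mem_support_tlWalk h₃ hx).2.1
      have h2 := (hw2.2 x hx').2
      omega
    · rw [w3, Walk.support_append, Walk.support_cons, List.tail_cons, List.mem_append,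
        Walk.support_reverse, List.mem_reverse] at hw
      rcases hw with hw | hw
      · exact (mem_support_tlWalk h₃ hw).1.2
      · exact (hw2.2 w hw).1
  -- stage 4: vertices in the top-right quarter or in the left half
  have hw4 : (w4 m γ₂ γ₃ γ₄).IsPath ∧
      ∀ w ∈ (w4 m γ₂ γ₃ γ₄).support, (m : ℤ) + 1 ≤ w 1 ∨ w 0 ≤ m := by
    refine ⟨isPath_append_cons _ (isPath_placed h₄).2.2.2 hw3.1 fun x hx hx' => ?_,
      fun w hw => ?_⟩
    · have h1 := (mem_support_trWalk h₄ hx).1.1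
      have h2 := hw3.2 x hx'
      omega
    · rw [w4, Walk.support_append, Walk.support_cons, List.tail_cons, List.mem_append] at hw
      rcases hw with hw | hw
      · exact Or.inl (mem_support_trWalk h₄ hw).2.1
      · exact Or.inr (hw3.2 w hw)
  refine isPath_append_cons _ (isPath_placed h₁).1 hw4.1 fun x hx hx' => ?_
  have h1 := mem_support_brWalk h₁ hx
  have h2 := hw4.2 x hx'
  omega

/-- The length of stage 1: the four walks and three cardinal edges.
[cite: DuminilCopinKozmaYadin2014, §2 (proof of Proposition 3)] -/
theorem length_w1 : (w1 m γ₁ γ₂ γ₃ γ₄).length =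
    γ₁.length + γ₂.length + γ₃.length + γ₄.length + 3 := by
  simp only [w1, w4, w3, w2, Walk.length_cons, Walk.length_append, Walk.length_reverse,
    (length_placed γ₁).1, (length_placed γ₂).2.2.1, (length_placed γ₃).2.1,
    (length_placed γ₄).2.2.2]
  ring

/-- The polygon has `4n+4` steps when the four walks have `n` steps each.
[cite: DuminilCopinKozmaYadin2014, §2 (proof of Proposition 3: "a (4n+4)-step polygon")] -/
theorem length_polygonWalk {n : ℕ} (h₁ : γ₁.length = n) (h₂ : γ₂.length = n) (h₃ : γ₃.length = n)
    (h₄ : γ₄.length = n) : (polygonWalk m γ₁ γ₂ γ₃ γ₄).length = 4 * n + 4 := by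
  rw [polygonWalk, Walk.length_cons, length_w1]
  omega

/-- **The polygon is a cycle** (a self-avoiding polygon). [cite: DuminilCopinKozmaYadin2014, §2 (proof of Proposition 3)] -/
theorem polygonWalk_isCycle (h₁ : IsSq m γ₁) (h₂ : IsSq m γ₂) (h₃ : IsSq m γ₃) (h₄ : IsSq m γ₄) :
    (polygonWalk m γ₁ γ₂ γ₃ γ₄).IsCycle := by
  rw [polygonWalk, Walk.cons_isCycle_iff]
  refine ⟨w1_isPath h₁ h₂ h₃ h₄, fun he => ?_⟩
  -- the closing edge joins the two ends of the path `w1`, which is longer than one edge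
  rw [Sym2.eq_swap] at he
  have hlen := (w1_isPath h₁ h₂ h₃ h₄).length_eq_one_of_mem_edges he
  rw [length_w1] at hlen
  omega

/-- The edge set of the polygon: the four cardinal edges and the edges of the four placed walks.
[cite: DuminilCopinKozmaYadin2014, §2 (proof of Proposition 3)] -/
theorem polygonEdges_eq : polygonEdges m γ₁ γ₂ γ₃ γ₄ =
    insert s(![(m : ℤ), 0], ![(m : ℤ) + 1, 0])
      ((brWalk m γ₁).edges.toFinset ∪
        insert s(![2 * (m : ℤ) + 1, m], ![2 * (m : ℤ) + 1, (m : ℤ) + 1])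
          ((trWalk m γ₄).edges.toFinset ∪
            insert s(![(m : ℤ) + 1, 2 * (m : ℤ) + 1], ![(m : ℤ), 2 * (m : ℤ) + 1])
              ((tlWalk m γ₃).edges.toFinset ∪
                insert s(![0, (m : ℤ) + 1], ![0, (m : ℤ)]) (blWalk m γ₂).edges.toFinset))) := by
  simp only [polygonEdges, polygonWalk, w1, w4, w3, w2, Walk.edges_cons, Walk.edges_append,
    Walk.edges_reverse, List.toFinset_cons, List.toFinset_append, List.toFinset_reverse]

/-- The four cardinal edges of `[0,2m+1]²` are edges of the polygon.
[cite: DuminilCopinKozmaYadin2014, §2 (proof of Proposition 3)] -/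
theorem cardinalEdges_subset_polygonEdges : cardinalEdges m ⊆ polygonEdges m γ₁ γ₂ γ₃ γ₄ := by
  intro e he
  rw [polygonEdges_eq]
  simp only [cardinalEdges, Finset.mem_insert, Finset.mem_singleton] at he
  rcases he with rfl | rfl | rfl | rfl
  · exact Finset.mem_insert_self _ _
  · exact Finset.mem_insert_of_mem (Finset.mem_union_right _ (Finset.mem_insert_self _ _))
  · refine Finset.mem_insert_of_mem (Finset.mem_union_right _ (Finset.mem_insert_of_mem
      (Finset.mem_union_right _ ?_)))
    rw [Sym2.eq_swap]
    exact Finset.mem_insert_self _ _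
  · refine Finset.mem_insert_of_mem (Finset.mem_union_right _ (Finset.mem_insert_of_mem
      (Finset.mem_union_right _ (Finset.mem_insert_of_mem (Finset.mem_union_right _ ?_)))))
    rw [Sym2.eq_swap]
    exact Finset.mem_insert_self _ _

/-- Every vertex of the polygon lies in the square `[0,2m+1]²`.
[cite: DuminilCopinKozmaYadin2014, §2 (proof of Proposition 3)] -/
theorem support_polygonWalk_subset (h₁ : IsSq m γ₁) (h₂ : IsSq m γ₂) (h₃ : IsSq m γ₃)
    (h₄ : IsSq m γ₄) {w : Site 2} (hw : w ∈ (polygonWalk m γ₁ γ₂ γ₃ γ₄).support) :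
    w ∈ squareBox m := by
  rw [mem_squareBox_iff, Fin.forall_fin_two]
  simp only [polygonWalk, w1, w4, w3, w2, Walk.support_cons, Walk.support_append, List.tail_cons,
    Walk.support_reverse, List.mem_cons, List.mem_append, List.mem_reverse] at hw
  rcases hw with rfl | hw | hw | hw | hw
  · simp only [Matrix.cons_val_zero, Matrix.cons_val_one]; omega
  · have := mem_support_brWalk h₁ hw; omega
  · have := mem_support_trWalk h₄ hw; omega
  · have := mem_support_tlWalk h₃ hw; omega
  · have := mem_support_blWalk h₂ hw; omega

/-- **The polygon belongs to `P_m`.** [cite: DuminilCopinKozmaYadin2014, §2 (proof of Proposition 3: "we obtain a (4n+4)-step polygon in P_m")] -/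
theorem polygonEdges_mem_facePolygons (h₁ : IsSq m γ₁) (h₂ : IsSq m γ₂) (h₃ : IsSq m γ₃)
    (h₄ : IsSq m γ₄) : polygonEdges m γ₁ γ₂ γ₃ γ₄ ∈ facePolygons m := by
  rw [mem_facePolygons_iff]
  refine ⟨fun e he => ?_, ⟨_, _, polygonWalk_isCycle h₁ h₂ h₃ h₄, rfl⟩,
    cardinalEdges_subset_polygonEdges⟩
  rw [polygonEdges, List.mem_toFinset] at he
  rw [mem_edgesIn_iff]
  exact ⟨Walk.edges_subset_edgeSet _ he, fun x hx =>
    support_polygonWalk_subset h₁ h₂ h₃ h₄ (mem_support_of_mem_edges' _ he hx)⟩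

/-- The polygon has `4n+4` edges. [cite: DuminilCopinKozmaYadin2014, §2 (proof of Proposition 3)] -/
theorem card_polygonEdges (h₁ : IsSq m γ₁) (h₂ : IsSq m γ₂) (h₃ : IsSq m γ₃) (h₄ : IsSq m γ₄)
    {n : ℕ} (hn₁ : γ₁.length = n) (hn₂ : γ₂.length = n) (hn₃ : γ₃.length = n)
    (hn₄ : γ₄.length = n) : (polygonEdges m γ₁ γ₂ γ₃ γ₄).card = 4 * n + 4 := by
  rw [polygonEdges, List.toFinset_card_of_nodup
    (polygonWalk_isCycle h₁ h₂ h₃ h₄).isCircuit.isTrail.edges_nodup, Walk.length_edges,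
    length_polygonWalk hn₁ hn₂ hn₃ hn₄]

/-! ### Recovering the four walks from the polygon -/

/-- The edges of the polygon inside each quarter are the edges of the corresponding placed
walk. [cite: DuminilCopinKozmaYadin2014, §2 (proof of Proposition 3)] -/
theorem sigEdges_polygonEdges (h₁ : IsSq m γ₁) (h₂ : IsSq m γ₂) (h₃ : IsSq m γ₃) (h₄ : IsSq m γ₄) :
    sigEdges m (true, false) (polygonEdges m γ₁ γ₂ γ₃ γ₄) = (brWalk m γ₁).edges.toFinset ∧
    sigEdges m (true, true) (polygonEdges m γ₁ γ₂ γ₃ γ₄) = (trWalk m γ₄).edges.toFinset ∧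
    sigEdges m (false, true) (polygonEdges m γ₁ γ₂ γ₃ γ₄) = (tlWalk m γ₃).edges.toFinset ∧
    sigEdges m (false, false) (polygonEdges m γ₁ γ₂ γ₃ γ₄) = (blWalk m γ₂).edges.toFinset := by
  have eB : sig m ![(m : ℤ), 0] ≠ sig m ![(m : ℤ) + 1, 0] := by simp [sig]
  have eR : sig m ![2 * (m : ℤ) + 1, m] ≠ sig m ![2 * (m : ℤ) + 1, (m : ℤ) + 1] := by
    simp [sig]
  have eT : sig m ![(m : ℤ) + 1, 2 * (m : ℤ) + 1] ≠ sig m ![(m : ℤ), 2 * (m : ℤ) + 1] := by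
    simp [sig]
  have eL : sig m ![0, (m : ℤ) + 1] ≠ sig m ![0, (m : ℤ)] := by simp [sig]
  obtain ⟨sbr, stl, sbl, str⟩ := And.intro (sig_placed h₁).1
    (And.intro (sig_placed h₃).2.1 (And.intro (sig_placed h₂).2.2.1 (sig_placed h₄).2.2.2))
  refine ⟨?_, ?_, ?_, ?_⟩ <;>
    simp only [polygonEdges_eq, sigEdges_insert_of_ne _ _ eB, sigEdges_insert_of_ne _ _ eR,
      sigEdges_insert_of_ne _ _ eT, sigEdges_insert_of_ne _ _ eL, sigEdges_union,
      sigEdges_edges_toFinset _ _ _ _ sbr, sigEdges_edges_toFinset _ _ _ _ stl,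
      sigEdges_edges_toFinset _ _ _ _ sbl, sigEdges_edges_toFinset _ _ _ _ str] <;>
    simp

/-- **The quadruple of squared walks is recovered from the polygon**: the construction is
injective. [cite: DuminilCopinKozmaYadin2014, §2 (proof of Proposition 3)] -/
theorem polygonEdges_injective {γ₁ γ₂ γ₃ γ₄ γ₁' γ₂' γ₃' γ₄' : (zdGraph 2).Walk (0 : Site 2) (diag m)}
    (h₁ : IsSq m γ₁) (h₂ : IsSq m γ₂) (h₃ : IsSq m γ₃) (h₄ : IsSq m γ₄)
    (h₁' : IsSq m γ₁') (h₂' : IsSq m γ₂') (h₃' : IsSq m γ₃') (h₄' : IsSq m γ₄')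
    (h : polygonEdges m γ₁ γ₂ γ₃ γ₄ = polygonEdges m γ₁' γ₂' γ₃' γ₄') :
    γ₁ = γ₁' ∧ γ₂ = γ₂' ∧ γ₃ = γ₃' ∧ γ₄ = γ₄' := by
  obtain ⟨ebr, etr, etl, ebl⟩ := sigEdges_polygonEdges h₁ h₂ h₃ h₄
  obtain ⟨ebr', etr', etl', ebl'⟩ := sigEdges_polygonEdges h₁' h₂' h₃' h₄'
  rw [h] at ebr etr etl ebl
  refine ⟨?_, ?_, ?_, ?_⟩
  · exact copy_map_injective _ _ _ (eq_of_isPath_of_edges_toFinset_eq (isPath_placed h₁).1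
      (isPath_placed h₁').1 (ebr.symm.trans ebr'))
  · exact copy_map_injective _ _ _ (eq_of_isPath_of_edges_toFinset_eq (isPath_placed h₂).2.2.1
      (isPath_placed h₂').2.2.1 (ebl.symm.trans ebl'))
  · exact copy_map_injective _ _ _ (eq_of_isPath_of_edges_toFinset_eq (isPath_placed h₃).2.1
      (isPath_placed h₃').2.1 (etl.symm.trans etl'))
  · exact copy_map_injective _ _ _ (eq_of_isPath_of_edges_toFinset_eq (isPath_placed h₄).2.2.2
      (isPath_placed h₄').2.2.2 (etr.symm.trans etr'))

end Polygon



end SquaredWalkPolygon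

end Literature.Probability.RandomPlanarGeometry.SAW
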